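import Summits.NavierStokesRegularity.NavierStokesRegularity.Theses.PerpetualPump
import Summits.NavierStokesRegularity.NavierStokesRegularity.Theorems.PerpetualPumpAveragedTypeIBlowupKernel
import Literature.Analysis.FluidPDE.TaoCascadeModeDuhamel

/-!
# Crux `PerpetualPump.AveragedTypeIBlowup` (stmt-NavierStokesRegularity-1835), line `Sketch`:
# the hand-off invariant of the window one-step theorem at time zero (`stub_invAtZero`, lead c1)
-/

noncomputable section
set_option linter.dupNamespace false
open MeasureTheory Set Filter Topology
open scoped ENNReal
open Literature.Analysis.FluidPDE Literature.Analysis.FluidPDE.Tao2016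
open Literature.Analysis.FluidPDE.TaoCascade (quadTerm IsSymmetricCoeff IsCancellingCoeff)

namespace Summit.NavierStokesRegularity.NavierStokesRegularity.Theorems.PerpetualPumpAveragedTypeIBlowup

/-- **Stub `invAtZero`** (tree vocabulary). THE HAND-OFF INVARIANT AT TIME ZERO: for the carrier datum
`A = −B < 0` at scale `0`, every solution of the seeded-Toda chain starts with `b₀(0) = B` (the kernel is `1` at
`τ = 0`, `stub_kernel`), no bond, no other modes, kernel majorants `M0₀(0) = |A| = B`, all others `0`; hence
`Inv 0 B 0` of the window one-step theorem (pinned as `Invo A Y 0 B 0`). [folklore] -/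
theorem stub_invAtZero :
    ∀ {ε₀ : ℝ}, 0 < ε₀ → ε₀ ≤ 1 / 20 → ∀ (𝒟 : CascadeWaveletData ε₀ 2) (r Dc εb : ℝ)
      (α : Fin 2 → Fin 2 → Fin 2 → ℤ × ℤ × ℤ → ℝ) (kern : Fin 2 → ℤ → ℝ → ℝ)
      (bvo wvo : (Fin 2 → ℤ → ℝ → ℝ) → ℤ → ℝ → ℝ) (M0o M1o : ℝ → (Fin 2 → ℤ → ℝ → ℝ) → ℤ → ℝ → ℝ)
      (q : ℝ) (R : ℤ → ℝ) (lad : ℕ → ℝ) (Sol : ℝ → ℝ → (Fin 2 → ℤ → ℝ → ℝ) → Prop),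
      0 < r → r ≤ (1 + ε₀ / 4) / 2 → (∀ i, 𝒟.radius i ≤ r ∧ ‖𝒟.center i‖ = 1 + ε₀ / 4) →
      Dc = 4 * Real.pi ^ 2 * ((1 + ε₀ / 4) ^ 2 + r ^ 2) → 0 < εb →
      α = (fun (i₁ i₂ i₃ : Fin 2) (μ : ℤ × ℤ × ℤ) =>
          if i₁ = 1 ∧ i₂ = 1 ∧ i₃ = 0 ∧ μ = (0, 0, 0) then Dc else
          if i₁ = 1 ∧ i₂ = 0 ∧ i₃ = 1 ∧ μ = (0, 0, 0) then -Dc / 2 else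
          if i₁ = 0 ∧ i₂ = 1 ∧ i₃ = 1 ∧ μ = (0, 0, 0) then -Dc / 2 else
          if i₁ = 1 ∧ i₂ = 0 ∧ i₃ = 1 ∧ μ = (0, 1, 0) then Dc / 2 else
          if i₁ = 0 ∧ i₂ = 1 ∧ i₃ = 1 ∧ μ = (1, 0, 0) then Dc / 2 else
          if i₁ = 1 ∧ i₂ = 1 ∧ i₃ = 0 ∧ μ = (0, 0, 1) then -Dc else
          if i₁ = 0 ∧ i₂ = 0 ∧ i₃ = 1 ∧ μ = (0, 0, 0) then εb * Dc else
          if i₁ = 0 ∧ i₂ = 1 ∧ i₃ = 0 ∧ μ = (0, 0, 0) then -(εb * Dc) / 2 else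
          if i₁ = 1 ∧ i₂ = 0 ∧ i₃ = 0 ∧ μ = (0, 0, 0) then -(εb * Dc) / 2 else 0) →
      (∀ (i : Fin 2) (n : ℤ) (τ : ℝ),
        kern i n τ = (pairing (heat τ (cascadeWavelet ε₀ (𝒟.ψ i) n)) (cascadeWavelet ε₀ (𝒟.ψ i) n)).re) →
      (∀ (Y : Fin 2 → ℤ → ℝ → ℝ) (n : ℤ) (t : ℝ), bvo Y n t = -((1 + ε₀) ^ ((n : ℝ) / 2) * Y 0 n t)) →
      (∀ (Y : Fin 2 → ℤ → ℝ → ℝ) (n : ℤ) (t : ℝ), wvo Y n t = (1 + ε₀) ^ ((n : ℝ) / 2) * Y 1 n t) →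
      (∀ (A : ℝ) (Y : Fin 2 → ℤ → ℝ → ℝ) (n : ℤ) (t : ℝ), M0o A Y n t = (1 + ε₀) ^ ((n : ℝ) / 2) *
        ((if n = 0 then |A| else 0) * (∫ ξ, Real.exp (-(heatRate ξ * t)) * modeWeight 𝒟 0 n ξ) +
          ∫ s in (0 : ℝ)..t, (∫ ξ, Real.exp (-(heatRate ξ * (t - s))) * modeWeight 𝒟 0 n ξ) *
            |quadTerm ε₀ α Y 0 n s|)) →
      (∀ (A : ℝ) (Y : Fin 2 → ℤ → ℝ → ℝ) (n : ℤ) (t : ℝ), M1o A Y n t = (1 + ε₀) ^ ((n : ℝ) / 2) *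
        ∫ s in (0 : ℝ)..t, (∫ ξ, Real.exp (-(heatRate ξ * (t - s))) * modeWeight 𝒟 1 n ξ) *
          |quadTerm ε₀ α Y 1 n s|) →
      q = Real.sqrt (1 + ε₀) → (∀ k : ℤ, R k = Dc * (1 + ε₀) ^ (2 * k)) →
      (∀ j : ℕ, lad j = εb * ((1 + ε₀) ^ (19 * (j - 2)))⁻¹) →
      (∀ (A S : ℝ) (Y : Fin 2 → ℤ → ℝ → ℝ), Sol A S Y ↔
        (0 < S ∧ (∀ i n, ContinuousOn (Y i n) (Ico 0 S)) ∧ (∀ i n t, n < 0 → Y i n t = 0) ∧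
        (∀ S' : ℝ, S' < S → ∃ C : ℝ, ∀ (i : Fin 2) (n : ℤ), ∀ t ∈ Icc 0 S',
          (1 + ε₀) ^ ((20 : ℝ) * n) * |Y i n t| ≤ C) ∧
        (∀ (i : Fin 2) (n : ℤ), ∀ t ∈ Ico 0 S,
          Y i n t = (if i = 0 ∧ n = 0 then A else 0) * kern i n t +
            ∫ s in (0 : ℝ)..t, kern i n (t - s) * quadTerm ε₀ α Y i n s))) →
      ∀ (F bhi : ℝ) (Invo : ℝ → (Fin 2 → ℤ → ℝ → ℝ) → ℤ → ℝ → ℝ → Prop),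
      (∀ (A : ℝ) (Y : Fin 2 → ℤ → ℝ → ℝ) (m : ℤ) (Bm t : ℝ), Invo A Y m Bm t ↔
        (bvo Y m t = Bm ∧ (∀ s ∈ Icc 0 t, bvo Y m s ≤ Bm) ∧
        (0 ≤ wvo Y m t ∧ wvo Y m t ≤ F * εb * Bm ∧ M1o A Y m t ≤ F * εb * Bm ∧ M0o A Y m t ≤ 2 * Bm) ∧
        (0 ≤ m - 1 → 0 ≤ wvo Y (m - 1) t ∧ q ^ 3 * Bm - 1 ≤ (wvo Y (m - 1) t) ^ 2 ∧
          (wvo Y (m - 1) t) ^ 2 ≤ q ^ 3 * Bm + 1 ∧ 9 / 20 ≤ bvo Y (m - 1) t ∧ bvo Y (m - 1) t ≤ 11 / 20 ∧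
          M0o A Y (m - 1) t ≤ 5 * (bhi + 4) ^ 2 ∧ M1o A Y (m - 1) t ≤ 5 * (bhi + 4) ^ 2) ∧
        (|bvo Y (m + 1) t| ≤ εb ∧ |wvo Y (m + 1) t| ≤ εb ∧ M0o A Y (m + 1) t ≤ εb ∧ M1o A Y (m + 1) t ≤ εb) ∧
        (∀ j : ℕ, 2 ≤ j → |bvo Y (m + j) t| ≤ lad j ∧ |wvo Y (m + j) t| ≤ lad j / 5 ∧
          M0o A Y (m + j) t ≤ lad j ∧ M1o A Y (m + j) t ≤ lad j) ∧
        (∀ j : ℕ, 1 ≤ j → ∀ s ∈ Icc 0 t, bvo Y (m + j) s ≤ 1 / 2) ∧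
        (∀ k : ℤ, 0 ≤ k → k ≤ m - 2 → ∃ te ∈ Icc 0 t,
          (-(2 / 5) ≤ bvo Y k te ∧ bvo Y k te ≤ 3 / 10 ∧ |wvo Y k te| ≤ 1 / 200 ∧
            M0o A Y k te ≤ 10 * (bhi + 4) ^ 2 ∧ M1o A Y k te ≤ 10 * (bhi + 4) ^ 2) ∧
          ∀ s ∈ Icc te t, -(9 / 20) ≤ bvo Y k s ∧ bvo Y k s ≤ 7 / 20 ∧ |wvo Y k s| ≤ 1 / 100 ∧
            M0o A Y k s ≤ 10 * (bhi + 4) ^ 2 + 1 ∧ M1o A Y k s ≤ 10 * (bhi + 4) ^ 2 + 1 ∧ |wvo Y (k - 1) s| ≤ 1 / 100 ∧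
            -(1 / 2) ≤ bvo Y (k + 1) s ∧ bvo Y (k + 1) s ≤ 9 / 10))) →
      ∀ (A S B : ℝ) (Y : Fin 2 → ℤ → ℝ → ℝ), Sol A S Y → A = -B → 0 < B → 0 ≤ F → Invo A Y 0 B 0 := by
  intro ε₀ hε₀ hε₀' 𝒟 r Dc εb α kern bvo wvo M0o M1o q R lad Sol hr hr2 hthin hDc hεb hα hkern hbvo hwvo hM0o hM1o hq hR
    hlad hSol F bhi Invo hInvo A S B Y hY hAB hB hF
  have hε₁ : ε₀ ≤ 1 := hε₀'.trans (by norm_num)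
  have hL : (0:ℝ) < 1 + ε₀ := by linarith
  obtain ⟨hS, -, -, -, hch⟩ := (hSol A S Y).1 hY
  -- values at time 0
  have hk0 : kern 0 0 0 = 1 := by rw [hkern]; exact (stub_kernel hε₀ hε₁ 𝒟 0 0).1
  have hY0 : ∀ (i : Fin 2) (n : ℤ), Y i n 0 = (if i = 0 ∧ n = 0 then A else 0) * kern i n 0 := fun i n => by
    rw [hch i n 0 ⟨le_rfl, hS⟩, intervalIntegral.integral_same, add_zero]
  have hY00 : Y 0 0 0 = A := by rw [hY0]; simp [hk0]
  have hYz : ∀ (i : Fin 2) (n : ℤ), ¬ (i = 0 ∧ n = 0) → Y i n 0 = 0 := fun i n h => by rw [hY0, if_neg h, zero_mul]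
  have hb0 : bvo Y 0 0 = B := by
    rw [hbvo, hY00, hAB]; simp
  have hbz : ∀ n : ℤ, n ≠ 0 → bvo Y n 0 = 0 := fun n hn => by
    rw [hbvo, hYz 0 n (fun h => hn h.2)]; simp
  have hwz : ∀ n : ℤ, wvo Y n 0 = 0 := fun n => by
    rw [hwvo, hYz 1 n (fun h => absurd h.1 (by decide))]; simp
  -- the kernel weight at time 0 is the kernel value 1
  have hK0 : ∀ n : ℤ, (∫ ξ, Real.exp (-(heatRate ξ * (0:ℝ))) * modeWeight 𝒟 0 n ξ) = kern 0 n 0 := fun n => by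
    rw [hkern, re_pairing_heat_cascadeWavelet_self, max_self]
  have hM0z : ∀ n : ℤ, n ≠ 0 → M0o A Y n 0 = 0 := fun n hn => by
    rw [hM0o, if_neg hn, intervalIntegral.integral_same]; simp
  have hM00 : M0o A Y 0 0 = |A| := by
    rw [hM0o, if_pos rfl, intervalIntegral.integral_same, hK0, hk0]; simp
  have hM1z : ∀ n : ℤ, M1o A Y n 0 = 0 := fun n => by
    rw [hM1o, intervalIntegral.integral_same]; simp
  have hAabs : |A| = B := by rw [hAB, abs_neg, abs_of_pos hB]
  have hlad0 : ∀ j : ℕ, 0 ≤ lad j := fun j => by rw [hlad]; positivity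
  have hFB : 0 ≤ F * εb * B := by positivity
  -- the invariant, clause by clause
  rw [hInvo]
  refine ⟨hb0, fun s hs => ?_, ⟨by rw [hwz], by rw [hwz]; exact hFB, by rw [hM1z]; exact hFB, by rw [hM00, hAabs]; linarith⟩,
    fun h => absurd h (by norm_num), ⟨?_, ?_, ?_, ?_⟩, fun j hj => ⟨?_, ?_, ?_, ?_⟩, fun j hj s hs => ?_, fun k hk hk2 => ?_⟩
  · have : s = 0 := le_antisymm hs.2 hs.1
    rw [this, hb0]
  · rw [hbz _ (by norm_num), abs_zero]; exact hεb.le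
  · rw [hwz, abs_zero]; exact hεb.le
  · rw [hM0z _ (by norm_num)]; exact hεb.le
  · rw [hM1z]; exact hεb.le
  · rw [hbz _ (by omega), abs_zero]; exact hlad0 j
  · rw [hwz, abs_zero]; exact div_nonneg (hlad0 j) (by norm_num)
  · rw [hM0z _ (by omega)]; exact hlad0 j
  · rw [hM1z]; exact hlad0 j
  · have : s = 0 := le_antisymm hs.2 hs.1
    rw [this, hbz _ (by omega)]; norm_num
  · exfalso; omega

end Summit.NavierStokesRegularity.NavierStokesRegularity.Theorems.PerpetualPumpAveragedTypeIBlowup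

end
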